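import Mathlib

/-!
# `FidelityWitnesses.RankTwoAdditivity` (stmt-MatrixMultiplication-4964) — pencil lemma

A two-form S-lemma: if a Hermitian form `E` is nonpositive on the null cone of a Hermitian form `G` which takes
both signs, then `E ≤ p·G` for some real `p` (`pencil_lemma`).  This replaces the Toeplitz–Hausdorff convexity
step in the existence of the interpolation parameter of the 2×2 certificate for the core inequality.
Supports item `stmt-MatrixMultiplication-4964`; no definitions are introduced.
-/

namespace Summit.MatrixMultiplication.MatrixMultiplication.Theorems.RankTwoAdditivity

open scoped ComplexConjugate

/-- Expansion of a Hermitian sesquilinear form along `α • v + w`. -/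
theorem hermitian_form_expand {V : Type*} [AddCommGroup V] [Module ℂ V] (S : V → V → ℂ)
    (h1 : ∀ (α : ℂ) (v w x : V), S (α • v + w) x = conj α * S v x + S w x)
    (h2 : ∀ (α : ℂ) (v w x : V), S x (α • v + w) = α * S x v + S x w)
    (hh : ∀ v w : V, S w v = conj (S v w)) (α : ℂ) (v w : V) :
    (S (α • v + w) (α • v + w)).re = ‖α‖ ^ 2 * (S v v).re + (S w w).re + 2 * (conj α * S v w).re := by
  rw [h1, h2, h2, hh v w]
  have : conj α * (α * S v v + S v w) + (α * conj (S v w) + S w w)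
      = ((‖α‖ ^ 2 : ℝ) : ℂ) * S v v + S w w + (conj α * S v w + conj (conj α * S v w)) := by
    rw [map_mul, Complex.conj_conj, Complex.ofReal_pow, ← Complex.mul_conj']; ring
  rw [this, Complex.add_conj, Complex.add_re, Complex.add_re, Complex.re_ofReal_mul, Complex.ofReal_re]

/-- **Pencil lemma.** Let `SE, SG` be Hermitian sesquilinear forms on a complex vector space with real
quadratic forms `E v = Re SE(v,v)`, `G v = Re SG(v,v)`. If `E ≤ 0` on `{G = 0}` and `G` takes both a positive
and a negative value, then there is `p : ℝ` with `E v ≤ p · G v` for all `v`.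
(Proof: for `G v > 0 > G w` two well-chosen `G`-null combinations `±rω•v + w` give `E v/G v ≤ E w/G w`;
take `p = sup {E v/G v : G v > 0}`.) [folklore] -/
theorem pencil_lemma {V : Type*} [AddCommGroup V] [Module ℂ V] (SE SG : V → V → ℂ)
    (hE₁ : ∀ (α : ℂ) (v w x : V), SE (α • v + w) x = conj α * SE v x + SE w x)
    (hE₂ : ∀ (α : ℂ) (v w x : V), SE x (α • v + w) = α * SE x v + SE x w)
    (hEh : ∀ v w : V, SE w v = conj (SE v w))
    (hG₁ : ∀ (α : ℂ) (v w x : V), SG (α • v + w) x = conj α * SG v x + SG w x)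
    (hG₂ : ∀ (α : ℂ) (v w x : V), SG x (α • v + w) = α * SG x v + SG x w)
    (hGh : ∀ v w : V, SG w v = conj (SG v w))
    (hslice : ∀ v : V, (SG v v).re = 0 → (SE v v).re ≤ 0)
    (hplus : ∃ v : V, 0 < (SG v v).re) (hminus : ∃ w : V, (SG w w).re < 0) :
    ∃ p : ℝ, ∀ v : V, (SE v v).re ≤ p * (SG v v).re := by
  have expE := hermitian_form_expand SE hE₁ hE₂ hEh
  have expG := hermitian_form_expand SG hG₁ hG₂ hGh
  -- the pair inequality:  G v > 0 > G w  ⟹  E w · G v ≤ E v · G w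
  have pair : ∀ v w : V, 0 < (SG v v).re → (SG w w).re < 0 →
      (SE w w).re * (SG v v).re ≤ (SE v v).re * (SG w w).re := by
    intro v w hv hw
    set g : ℂ := SG v w with hg
    -- unit complex ω with Re(conj ω · g) = 0
    obtain ⟨ω, hω1, hω0⟩ : ∃ ω : ℂ, ‖ω‖ = 1 ∧ (conj ω * g).re = 0 := by
      by_cases hg0 : g = 0
      · exact ⟨1, by simp, by simp [hg0]⟩
      · have hgn : ‖g‖ ≠ 0 := norm_ne_zero_iff.2 hg0
        refine ⟨(Complex.I * g) * ((‖g‖⁻¹ : ℝ) : ℂ), ?_, ?_⟩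
        · rw [norm_mul, norm_mul, Complex.norm_I, one_mul, Complex.norm_real, Real.norm_of_nonneg
            (inv_nonneg.2 (norm_nonneg _)), mul_inv_cancel₀ hgn]
        · have : conj ((Complex.I * g) * ((‖g‖⁻¹ : ℝ) : ℂ)) * g
              = (-Complex.I) * (((‖g‖ ^ 2 * ‖g‖⁻¹ : ℝ)) : ℂ) := by
            rw [map_mul, map_mul, Complex.conj_I, Complex.conj_ofReal]
            push_cast
            rw [← Complex.mul_conj' g]; ring
          rw [this, Complex.mul_re, Complex.ofReal_re, Complex.ofReal_im]
          simp
    set r : ℝ := Real.sqrt (-(SG w w).re / (SG v v).re) with hr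
    have hr2 : r ^ 2 = -(SG w w).re / (SG v v).re := Real.sq_sqrt (by apply div_nonneg <;> linarith)
    have hr2' : r ^ 2 * (SG v v).re + (SG w w).re = 0 := by
      rw [hr2]; field_simp; ring
    -- the two null vectors
    have hnull : ∀ s : ℝ, s ^ 2 = r ^ 2 →
        (SG ((((s : ℝ) : ℂ) * ω) • v + w) ((((s : ℝ) : ℂ) * ω) • v + w)).re = 0 := by
      intro s hs
      rw [expG]
      have e1 : ‖((s : ℂ) * ω)‖ ^ 2 = s ^ 2 := by
        rw [norm_mul, Complex.norm_real, Real.norm_eq_abs, hω1, mul_one, sq_abs]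
      have e2 : (conj ((s : ℂ) * ω) * SG v w).re = s * (conj ω * g).re := by
        rw [map_mul, Complex.conj_ofReal, mul_assoc, Complex.re_ofReal_mul]
      rw [e1, e2, hω0, mul_zero, mul_zero, add_zero, hs]
      exact hr2'
    have h₁ := hslice _ (hnull r rfl)
    have h₂ := hslice _ (hnull (-r) (by ring))
    rw [expE] at h₁ h₂
    have e1 : ‖((r : ℂ) * ω)‖ ^ 2 = r ^ 2 := by
      rw [norm_mul, Complex.norm_real, Real.norm_eq_abs, hω1, mul_one, sq_abs]
    have e2 : ‖(((-r : ℝ) : ℂ) * ω)‖ ^ 2 = r ^ 2 := by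
      rw [norm_mul, Complex.norm_real, Real.norm_eq_abs, hω1, mul_one, abs_neg, sq_abs]
    have e3 : (conj (((-r : ℝ) : ℂ) * ω) * SE v w).re = -(conj ((r : ℂ) * ω) * SE v w).re := by
      have : conj (((-r : ℝ) : ℂ) * ω) = -(conj ((r : ℂ) * ω)) := by
        rw [Complex.ofReal_neg, neg_mul, map_neg]
      rw [this, neg_mul, Complex.neg_re]
    rw [e1] at h₁
    rw [e2, e3] at h₂
    have hsum : r ^ 2 * (SE v v).re + (SE w w).re ≤ 0 := by linarith
    -- r² G v = −G w
    have hr2'' : r ^ 2 * (SG v v).re = -(SG w w).re := by linarith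
    -- multiply hsum by G v > 0
    have h3 := mul_le_mul_of_nonneg_right hsum hv.le
    have h4 : r ^ 2 * (SE v v).re * (SG v v).re = -((SE v v).re * (SG w w).re) := by
      rw [mul_comm (r ^ 2), mul_assoc, hr2'']; ring
    nlinarith [h3, h4]
  -- define p as the supremum of the ratios over {G > 0}
  obtain ⟨w₀, hw₀⟩ := hminus
  set S : Set ℝ := {t | ∃ v : V, 0 < (SG v v).re ∧ t = (SE v v).re / (SG v v).re} with hS
  have hSne : S.Nonempty := by
    obtain ⟨v₀, hv₀⟩ := hplus; exact ⟨_, v₀, hv₀, rfl⟩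
  have hbound : ∀ w : V, (SG w w).re < 0 → ∀ t ∈ S, t ≤ (SE w w).re / (SG w w).re := by
    rintro w hw t ⟨v, hv, rfl⟩
    have h := pair v w hv hw
    rw [← sub_nonpos, div_sub_div _ _ (ne_of_gt hv) (ne_of_lt hw)]
    apply div_nonpos_iff.2
    left
    exact ⟨by nlinarith [h], (mul_neg_of_pos_of_neg hv hw).le⟩
  have hSbdd : BddAbove S := ⟨_, hbound w₀ hw₀⟩
  refine ⟨sSup S, fun v => ?_⟩
  rcases lt_trichotomy 0 (SG v v).re with hv | hv | hv
  · -- G v > 0 : E v / G v ≤ sup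
    have hmem : (SE v v).re / (SG v v).re ∈ S := ⟨v, hv, rfl⟩
    have := le_csSup hSbdd hmem
    rwa [div_le_iff₀ hv] at this
  · -- G v = 0
    rw [← hv, mul_zero]; exact hslice v hv.symm
  · -- G v < 0 : sup ≤ E v / G v
    have := csSup_le hSne (hbound v hv)
    rw [le_div_iff_of_neg hv] at this
    linarith

end Summit.MatrixMultiplication.MatrixMultiplication.Theorems.RankTwoAdditivity
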